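import Mathlib
import HarnessLib
import Summits.ABC.ABC.Theses.DefiniteXi

/-!
# Proof attempt: `xiStrongBound_of_split` (card eisenstein-part-quarantine, first lemma)
-/

namespace Summit.ABC.ABC.Cruxes.XiStrongBound.SplitProof

open Literature.NumberTheory.EllipticCurves Literature.NumberTheory.Automorphic

noncomputable section

def sixPart (n : ℕ) : ℕ := 2 ^ (n.factorization 2) * 3 ^ (n.factorization 3)

def coprimeSixPart (n : ℕ) : ℕ := n / sixPart n

def xiFrey (a b : ℤ) (N Nm : ℕ) : ℕ :=
  brandtXi (N / Nm) Nm (fun n => (freyCurve a b).LFunction n)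

def tamExp (a b : ℤ) (Nm : ℕ) : ℕ :=
  ∏ q ∈ Nm.primeFactors, ((freyCurve a b).minimalDiscriminantNorm ℤ).factorization q

def oddTamExp (a b : ℤ) (N : ℕ) : ℕ :=
  ∏ q ∈ N.primeFactors.erase 2, ((freyCurve a b).minimalDiscriminantNorm ℤ).factorization q

def EisQuarantine : Prop :=
  ∃ B : ℝ, 0 ≤ B ∧ ∀ ε : ℝ, 0 < ε → ∃ C : ℝ, ∀ a b : ℤ, IsCoprime a b → a * b * (a + b) ≠ 0 →
    ∀ (N : ℕ) [NeZero N], (freyCurve a b).conductorNorm ℤ = N →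
    ∀ Nm : ℕ, Odd Nm → Squarefree Nm → Odd Nm.primeFactors.card → Nm ∣ N →
      (sixPart (xiFrey a b N Nm) : ℝ) ≤ C * (N : ℝ) ^ ε * (oddTamExp a b N : ℝ) ^ B

def IrrCore : Prop :=
  ∀ ε : ℝ, 0 < ε → ∃ C : ℝ, ∀ a b : ℤ, IsCoprime a b → a * b * (a + b) ≠ 0 →
    ∀ (N : ℕ) [NeZero N], (freyCurve a b).conductorNorm ℤ = N →
    ∀ Nm : ℕ, Odd Nm → Squarefree Nm → Odd Nm.primeFactors.card → Nm ∣ N →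
      (coprimeSixPart (xiFrey a b N Nm) : ℝ) * (tamExp a b Nm : ℝ) ≤ C * (N : ℝ) ^ (2 + ε)

def TBound : Prop :=
  ∀ ε : ℝ, 0 < ε → ∃ C : ℝ, ∀ a b : ℤ, IsCoprime a b → a * b * (a + b) ≠ 0 →
    ∀ (N : ℕ) [NeZero N], (freyCurve a b).conductorNorm ℤ = N →
      (oddTamExp a b N : ℝ) ≤ C * (N : ℝ) ^ ε

theorem sixPart_dvd (n : ℕ) : sixPart n ∣ n := by
  unfold sixPart
  have h2 : 2 ^ (n.factorization 2) ∣ n := Nat.ordProj_dvd n 2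
  have h3 : 3 ^ (n.factorization 3) ∣ n := Nat.ordProj_dvd n 3
  have hc : Nat.Coprime (2 ^ (n.factorization 2)) (3 ^ (n.factorization 3)) :=
    Nat.Coprime.pow _ _ (by norm_num)
  exact Nat.Coprime.mul_dvd_of_dvd_of_dvd hc h2 h3

theorem sixPart_mul_coprimeSixPart (n : ℕ) : sixPart n * coprimeSixPart n = n :=
  Nat.mul_div_cancel' (sixPart_dvd n)

theorem xiStrongBound_of_split :
    EisQuarantine → IrrCore → TBound → Summit.ABC.ABC.Theses.DefiniteXi.XiStrongBound := by
  rintro ⟨B, hB0, hE⟩ hI hT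
  intro ε hε
  set ε₁ : ℝ := ε / (2 + B) with hε₁
  have h2B : 0 < 2 + B := by linarith
  have hε₁pos : 0 < ε₁ := div_pos hε h2B
  obtain ⟨C₁, hC₁⟩ := hE ε₁ hε₁pos
  obtain ⟨C₂, hC₂⟩ := hI ε₁ hε₁pos
  obtain ⟨C₃, hC₃⟩ := hT ε₁ hε₁pos
  refine ⟨max C₁ 0 * max C₂ 0 * (max C₃ 0) ^ B, ?_⟩
  intro a b hab hne N _ hN Nm hodd hsq hcard hdvd
  have hNpos : (0 : ℝ) < (N : ℝ) := by
    have : (N : ℕ) ≠ 0 := NeZero.ne N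
    exact_mod_cast Nat.pos_of_ne_zero this
  -- the three inputs
  have h1 := hC₁ a b hab hne N hN Nm hodd hsq hcard hdvd
  have h2 := hC₂ a b hab hne N hN Nm hodd hsq hcard hdvd
  have h3 := hC₃ a b hab hne N hN
  -- abbreviations
  set ξ : ℕ := xiFrey a b N Nm with hξ
  set T : ℝ := (oddTamExp a b N : ℝ) with hTdef
  have hT0 : 0 ≤ T := by positivity
  have hsix0 : (0 : ℝ) ≤ (sixPart ξ : ℝ) := by positivity
  have hcop0 : (0 : ℝ) ≤ (coprimeSixPart ξ : ℝ) * (tamExp a b Nm : ℝ) := by positivity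
  -- replace constants by their nonnegative versions
  have h1' : (sixPart ξ : ℝ) ≤ max C₁ 0 * (N : ℝ) ^ ε₁ * T ^ B := by
    refine h1.trans ?_
    have hx : 0 ≤ (N : ℝ) ^ ε₁ * T ^ B := by positivity
    calc C₁ * (N : ℝ) ^ ε₁ * T ^ B = C₁ * ((N : ℝ) ^ ε₁ * T ^ B) := by ring
      _ ≤ max C₁ 0 * ((N : ℝ) ^ ε₁ * T ^ B) :=
          mul_le_mul_of_nonneg_right (le_max_left _ _) hx
      _ = max C₁ 0 * (N : ℝ) ^ ε₁ * T ^ B := by ring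
  have h2' : (coprimeSixPart ξ : ℝ) * (tamExp a b Nm : ℝ) ≤ max C₂ 0 * (N : ℝ) ^ (2 + ε₁) := by
    refine h2.trans ?_
    have hx : 0 ≤ (N : ℝ) ^ (2 + ε₁) := by positivity
    exact mul_le_mul_of_nonneg_right (le_max_left _ _) hx
  have h3' : T ≤ max C₃ 0 * (N : ℝ) ^ ε₁ := by
    refine h3.trans ?_
    have hx : 0 ≤ (N : ℝ) ^ ε₁ := by positivity
    exact mul_le_mul_of_nonneg_right (le_max_left _ _) hx
  have hTB : T ^ B ≤ (max C₃ 0 * (N : ℝ) ^ ε₁) ^ B := Real.rpow_le_rpow hT0 h3' hB0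
  have hTB' : (max C₃ 0 * (N : ℝ) ^ ε₁) ^ B = (max C₃ 0) ^ B * (N : ℝ) ^ (ε₁ * B) := by
    rw [Real.mul_rpow (le_max_right _ _) (by positivity), ← Real.rpow_mul hNpos.le]
  -- product identity ξ = sixPart ξ * coprimeSixPart ξ
  have hprod : (brandtXi (N / Nm) Nm (fun n => (freyCurve a b).LFunction n) : ℝ) *
      ∏ q ∈ Nm.primeFactors, ((((freyCurve a b).minimalDiscriminantNorm ℤ).factorization q : ℕ) : ℝ)
      = (sixPart ξ : ℝ) * ((coprimeSixPart ξ : ℝ) * (tamExp a b Nm : ℝ)) := by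
    have hnat : (xiFrey a b N Nm : ℝ) = (sixPart ξ : ℝ) * (coprimeSixPart ξ : ℝ) := by
      rw [hξ]; exact_mod_cast (sixPart_mul_coprimeSixPart (xiFrey a b N Nm)).symm
    have htam : (tamExp a b Nm : ℝ) =
        ∏ q ∈ Nm.primeFactors, ((((freyCurve a b).minimalDiscriminantNorm ℤ).factorization q : ℕ) : ℝ) := by
      unfold tamExp; push_cast; rfl
    rw [← htam]
    have : (brandtXi (N / Nm) Nm (fun n => (freyCurve a b).LFunction n) : ℝ) = (xiFrey a b N Nm : ℝ) := rfl
    rw [this, hnat]; ring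
  rw [hprod]
  -- combine
  have hstep1 : (sixPart ξ : ℝ) * ((coprimeSixPart ξ : ℝ) * (tamExp a b Nm : ℝ))
      ≤ (max C₁ 0 * (N : ℝ) ^ ε₁ * T ^ B) * (max C₂ 0 * (N : ℝ) ^ (2 + ε₁)) := by
    refine mul_le_mul h1' h2' hcop0 ?_
    exact hsix0.trans h1'
  refine hstep1.trans ?_
  have hstep2 : max C₁ 0 * (N : ℝ) ^ ε₁ * T ^ B * (max C₂ 0 * (N : ℝ) ^ (2 + ε₁))
      ≤ max C₁ 0 * (N : ℝ) ^ ε₁ * ((max C₃ 0) ^ B * (N : ℝ) ^ (ε₁ * B)) * (max C₂ 0 * (N : ℝ) ^ (2 + ε₁)) := by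
    rw [← hTB']
    have hA : 0 ≤ max C₁ 0 * (N : ℝ) ^ ε₁ := by positivity
    have hD : 0 ≤ max C₂ 0 * (N : ℝ) ^ (2 + ε₁) := by positivity
    have := mul_le_mul_of_nonneg_left hTB hA
    exact mul_le_mul_of_nonneg_right this hD
  refine hstep2.trans (le_of_eq ?_)
  -- exponent bookkeeping: ε₁ + ε₁*B + (2+ε₁) = 2 + ε
  have hexp : (N : ℝ) ^ ε₁ * (N : ℝ) ^ (ε₁ * B) * (N : ℝ) ^ (2 + ε₁) = (N : ℝ) ^ (2 + ε) := by
    rw [← Real.rpow_add hNpos, ← Real.rpow_add hNpos]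
    congr 1
    have : ε₁ * (2 + B) = ε := by rw [hε₁]; field_simp
    linarith
  calc max C₁ 0 * (N : ℝ) ^ ε₁ * ((max C₃ 0) ^ B * (N : ℝ) ^ (ε₁ * B)) * (max C₂ 0 * (N : ℝ) ^ (2 + ε₁))
      = max C₁ 0 * max C₂ 0 * (max C₃ 0) ^ B * ((N : ℝ) ^ ε₁ * (N : ℝ) ^ (ε₁ * B) * (N : ℝ) ^ (2 + ε₁)) := by ring
    _ = max C₁ 0 * max C₂ 0 * (max C₃ 0) ^ B * (N : ℝ) ^ (2 + ε) := by rw [hexp]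

end

end Summit.ABC.ABC.Cruxes.XiStrongBound.SplitProof
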